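import Mathlib
import Literature.AlgebraicGeometry.Resolution.TranscendenceDefect
import Literature.AlgebraicGeometry.Resolution.AbhyankarBases
import Literature.AlgebraicGeometry.Resolution.ValuedFunctionFields
import Literature.AlgebraicGeometry.Resolution.NormalizationFractions
import Summits.ResolutionOfSingularities.ResolutionOfSingularities.Theorems.ValuativeLuAlphaPTorsorAPFlagAssembly
import Summits.ResolutionOfSingularities.ResolutionOfSingularities.Theorems.ValuativeLuAlphaPTorsorAPFlagFinal
import Summits.ResolutionOfSingularities.ResolutionOfSingularities.Theorems.ValuativeLuAlphaPTorsorAdaptedValueStepClaimC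
import Summits.ResolutionOfSingularities.ResolutionOfSingularities.Theorems.AbhyankarShadowsSemivaluationShadowsQfgRankOne
import HarnessLib

/-!
# Quasi-finite generation for rational Abhyankar valuations of higher rank

Crux `SemivaluationShadows` (stmt-ResolutionOfSingularities-16757), line `birth`, registered stub
`stub_qfgHigherRank` (statement `Sig.stub_qfgHigherRank` of
`Cruxes/SemivaluationShadows/Lines/birth.lean`, conclusion `IsQFGModel O R R₁` written out).

**Statement.** `k` algebraically closed of characteristic `p`, `K/k` finitely generated, `O ∋ k`
a RATIONAL valuation ring of `K` (every element of `O` is congruent to a constant modulo `𝔪_O`)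
which is ABHYANKAR (`transcendenceDefect k O = 0`) and whose value group is not archimedean
(rank `≥ 2`; this hypothesis is carried but not used — the proof works in every rank): above
every finitely generated `R ⊆ O` there is a finitely generated `R₁`, `R ≤ R₁ ⊆ O`, `Frac R₁ = K`,
whose value semigroup `ν(R₁)` (a submonoid of the value group with zero) is finitely generated
— Teissier's "quasi-finite generation" of the semigroup of an Abhyankar valuation after a local
blowing up (Teissier 2014, Thm. 6.21 / Cor. 6.22; Knaf–Kuhlmann 2005, Thm. 1.1 for the local
uniformization behind it).

**Proof (tree machinery of the `Valuative` route, namespace `…Theorems.PfaffLine`).**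
(1) rational ⇒ zero-dimensional (`X - c` kills `x` modulo `𝔪_O`);
(2) `transcendenceDefect = 0` ⇒ `IsAbhyankarPlace O k K` (landed with the rank-one sibling:
`isAbhyankarPlace_top_of_transcendenceDefect_eq_zero`, via an Abhyankar transcendence basis);
(3) a FLAG-ADAPTED very good chart `(R₀, x, lv)` of `K` along `O` with value torsion
(`ap_flag_chart_top`, fed with the landed value step `stub_adaptedValueStep`), then absorption of
the non-zero generators of `R` (`ap_flag_chart_absorbing`): a flag-adapted chart `(R₁, x', lv')`
with `R₀ ≤ R₁`, `R ≤ R₁`;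
(4) on a flag-adapted chart EVERY non-zero `a ∈ R₁` has the value of a monomial `x'^μ`, `μ ∈ ℕⁿ`
(`adValue_claimC`, the level-by-level dominant-term lemma of the adapted value step, applied at a
level above all levels, where the level ideal is `⊥`), so `ν(R₁) = {0} ∪ ℕ⟨ν(x'ᵢ)⟩` is the
submonoid generated by the finitely many `ν(x'ᵢ)` and `0`;
(5) `Frac R₁ = K` since already `K = Frac R₀`.

## Sources
* B. Teissier, *Overweight deformations of affine toric varieties and local uniformization*,
  in: Valuation Theory in Interaction, EMS 2014, Thm. 6.21, Cor. 6.22. [Teissier2014]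
* H. Knaf, F.-V. Kuhlmann, *Abhyankar places admit local uniformization in any characteristic*,
  Ann. Sci. ÉNS 38 (2005), Thm. 1.1. [KnafKuhlmann2005]
-/

-- single-problem summit: the doubled namespace component `ResolutionOfSingularities` is forced
set_option linter.dupNamespace false

noncomputable section

namespace Summit.ResolutionOfSingularities.ResolutionOfSingularities.Theorems

open IsLocalRing Literature.AlgebraicGeometry.Resolution
open Summit.ResolutionOfSingularities.ResolutionOfSingularities.Theorems.PfaffLine

/-! ## (1) Rational places are zero-dimensional -/

/-- **A rational place is zero-dimensional**: if every `x ∈ O` is congruent to a constant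
`c ∈ k` modulo `𝔪_O`, then `x` is a root modulo `𝔪_O` of the non-zero polynomial `X - c`.
[folklore] -/
theorem qfgHigherRank_zeroDim_of_rational {k K : Type} [Field k] [Field K] [Algebra k K]
    (O : ValuationSubring K)
    (hrat : ∀ x : K, x ∈ O → ∃ c : k, O.valuation (x - algebraMap k K c) < 1) :
    ∀ x : K, x ∈ O → ∃ f : Polynomial k, f ≠ 0 ∧ Polynomial.aeval x f ∈ O.nonunits := by
  intro x hx
  obtain ⟨c, hc⟩ := hrat x hx
  refine ⟨Polynomial.X - Polynomial.C c, Polynomial.X_sub_C_ne_zero c, ?_⟩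
  rw [ValuationSubring.mem_nonunits_iff]
  simpa only [map_sub, Polynomial.aeval_X, Polynomial.aeval_C] using hc

/-! ## (2) Transcendence defect zero ⇒ Abhyankar place: landed as
`isAbhyankarPlace_top_of_transcendenceDefect_eq_zero` (file
`AbhyankarShadowsSemivaluationShadowsQfgRankOne.lean`, imported). -/

/-! ## (4) Values on a flag-adapted chart are monomial values -/

/-- **Dominant monomial on a flag-adapted chart (any rank).** On a flag-adapted very good chart
`(R, x, lv)` along `O`, every non-zero `r ∈ R` has the value of a monomial in the parameters:
`v(r) = ∏ v(xⱼ)^{μ j}` with `μ ∈ ℕⁿ`. This is the tree's level-by-level dominant-term lemma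
`adValue_claimC` read at a level `ℓ` exceeding all levels, where the level ideal
`(xᵢ : lv i ≥ ℓ)` is `⊥`, so that by clause (C3) the non-zero `r` is not smaller than every
Laurent monomial. No rank hypothesis. [folklore] -/
theorem qfgHigherRank_flag_dominant_monomial {k K : Type} [Field k] [Field K] [Algebra k K]
    (O : ValuationSubring K) {n : ℕ} (R : Subalgebra k K) (hRO : R.toSubring ≤ O.toSubring)
    (x : Fin n → K) (hx : ∀ i, x i ∈ R) (lv : Fin n → ℕ) (hflag : FlagAdaptedChart O R hRO x hx lv)
    {r : K} (hr : r ∈ R) (hr0 : r ≠ 0) :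
    ∃ μ : Fin n → ℕ, O.valuation r = ∏ j, O.valuation (x j) ^ (μ j) := by
  classical
  obtain ⟨⟨-, hx0, -, hind, ⟨hC2a, -, -⟩, hC3⟩, hLA⟩ := hflag
  -- a level above all levels: the level ideal is `⊥`
  set ℓ : ℕ := Finset.univ.sup lv + 1 with hℓ
  have hlt : ∀ j, lv j < ℓ := fun j =>
    Nat.lt_succ_of_le (Finset.le_sup (f := lv) (Finset.mem_univ j))
  haveI : IsEmpty {i : Fin n // ℓ ≤ lv i} := ⟨fun i => absurd i.2 (not_le.mpr (hlt i.1))⟩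
  have hnot : (⟨r, hr⟩ : R.toSubring) ∉ Ideal.span (Set.range
      fun i : {i : Fin n // ℓ ≤ lv i} => (⟨x i.1, hx i.1⟩ : R.toSubring)) := by
    rw [Set.range_eq_empty, Ideal.span_empty, Ideal.mem_bot]
    exact fun h => hr0 (congrArg Subtype.val h)
  have h2 : ¬ ∀ m : Fin n → ℤ, (∀ j, ℓ ≤ lv j → m j = 0) →
      O.valuation r < ∏ j, O.valuation (x j) ^ (m j) := fun h => hnot ((hC3 ℓ ⟨r, hr⟩).mpr h)
  push Not at h2
  obtain ⟨m, hm, hle⟩ := h2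
  obtain ⟨μ, -, hμ⟩ := adValue_claimC O R hRO x hx lv hx0 hC2a hC3 hind hLA ℓ r hr ⟨m, hm, hle⟩
  exact ⟨μ, hμ⟩

/-- **The value semigroup of a flag-adapted chart is finitely generated**: it is the submonoid of
the value group with zero generated by `0 = v(0)` and the values `v(xᵢ)` of the parameters
(`qfgHigherRank_flag_dominant_monomial`). [cite: Teissier2014, Thm. 6.21 / Cor. 6.22] -/
theorem qfgHigherRank_flag_semigroup_fg {k K : Type} [Field k] [Field K] [Algebra k K]
    (O : ValuationSubring K) {n : ℕ} (R : Subalgebra k K) (hRO : R.toSubring ≤ O.toSubring)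
    (x : Fin n → K) (hx : ∀ i, x i ∈ R) (lv : Fin n → ℕ) (hflag : FlagAdaptedChart O R hRO x hx lv) :
    (MonoidHom.mrange (O.valuation.toMonoidWithZeroHom.toMonoidHom.comp
      R.val.toRingHom.toMonoidHom)).FG := by
  classical
  set φ := O.valuation.toMonoidWithZeroHom.toMonoidHom.comp R.val.toRingHom.toMonoidHom with hφ
  have hφ_apply : ∀ r : R, φ r = O.valuation (r : K) := fun r => rfl
  refine ⟨insert 0 (Finset.univ.image fun i => O.valuation (x i)), le_antisymm ?_ ?_⟩
  · -- the generators are values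
    refine Submonoid.closure_le.mpr fun γ hγ => ?_
    rw [Finset.coe_insert, Set.mem_insert_iff, Finset.mem_coe, Finset.mem_image] at hγ
    rcases hγ with rfl | ⟨i, -, rfl⟩
    · exact ⟨0, by rw [hφ_apply, ZeroMemClass.coe_zero, map_zero]⟩
    · exact ⟨⟨x i, hx i⟩, rfl⟩
  · -- every value is a monomial value (or `0`)
    rintro γ ⟨r, rfl⟩
    by_cases hr0 : (r : K) = 0
    · rw [hφ_apply, hr0, map_zero]
      exact Submonoid.subset_closure (by simp)
    · obtain ⟨μ, hμ⟩ := qfgHigherRank_flag_dominant_monomial O R hRO x hx lv hflag r.2 hr0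
      rw [hφ_apply, hμ]
      refine Submonoid.prod_mem _ fun i _ => Submonoid.pow_mem _ (Submonoid.subset_closure ?_) _
      simp

/-! ## The stub, binder form -/

/-- **Quasi-finite generation for rational Abhyankar valuation rings of higher rank** (binder
form of the registered statement `Sig.stub_qfgHigherRank` of line `birth` of crux
`SemivaluationShadows`, conclusion `IsQFGModel O R R₁` unfolded). Over an algebraically closed
`k` of characteristic `p`, `K/k` finitely generated, `O ∋ k` a rational valuation ring of `K`
with `transcendenceDefect k O = 0` (Abhyankar) whose value group is not archimedean: above every
finitely generated `R ⊆ O` there is a finitely generated `R₁`, `R ≤ R₁ ⊆ O`, `Frac R₁ = K`, with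
finitely generated value semigroup. Proof: module docstring — a flag-adapted very good chart of
`K` absorbing the generators of `R` (`ap_flag_chart_top`, `ap_flag_chart_absorbing`, value step
`stub_adaptedValueStep`), on which every value is a monomial value (`adValue_claimC`). The
non-archimedean hypothesis is not used (the argument is rank-free).
[cite: Teissier2014, Thm. 6.21 / Cor. 6.22; KnafKuhlmann2005, Thm. 1.1] -/
theorem qfgHigherRank (p : ℕ) (hp : p.Prime) (k K : Type) [Field k] [CharP k p] [IsAlgClosed k]
    [Field K] [Algebra k K] (hfg : (⊤ : IntermediateField k K).FG) (O : ValuationSubring K)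
    (hk : ∀ c : k, algebraMap k K c ∈ O)
    (hrat : ∀ x : K, x ∈ O → ∃ c : k, O.valuation (x - algebraMap k K c) < 1)
    (hD : Literature.AlgebraicGeometry.Resolution.transcendenceDefect k O hk = 0)
    (_hnr1 : ¬ (∀ z w : K, O.valuation z < 1 → w ≠ 0 → ∃ N : ℕ, O.valuation z ^ N < O.valuation w))
    (R : Subalgebra k K) (hR : R.FG) (hRO : R.toSubring ≤ O.toSubring) :
    ∃ R₁ : Subalgebra k K, R ≤ R₁ ∧ R₁.toSubring ≤ O.toSubring ∧ R₁.FG ∧ IsFractionRing R₁ K ∧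
      (MonoidHom.mrange (O.valuation.toMonoidWithZeroHom.toMonoidHom.comp
        R₁.val.toRingHom.toMonoidHom)).FG := by
  classical
  -- (1)–(2): zero-dimensional and Abhyankar (`_hnr1`, the rank hypothesis, is not used)
  have hzd := qfgHigherRank_zeroDim_of_rational O hrat
  have hA := isAbhyankarPlace_top_of_transcendenceDefect_eq_zero hfg O hk hD
  obtain ⟨s, hs⟩ := hfg
  -- (3): a flag-adapted chart of `K` …
  obtain ⟨n, R₀, hR₀O, x, hx, lv, hfrac, hflag, htors, -⟩ :=
    ap_flag_chart_top stub_adaptedValueStep hp O hk hzd hA s hs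
  -- … absorbing the non-zero generators of `R`
  obtain ⟨g, hg⟩ := hR
  have hgR : ∀ z ∈ g, z ∈ R := fun z hz => by rw [← hg]; exact Algebra.subset_adjoin hz
  set g₁ : Finset K := g.filter fun z => z ≠ 0 with hg₁
  let a : Fin g₁.card → K := fun j => (g₁.equivFin.symm j : K)
  have hag₁ : ∀ j, a j ∈ g₁ := fun j => (g₁.equivFin.symm j).2
  have haO : ∀ j, a j ∈ O := fun j => hRO (hgR _ (Finset.mem_filter.mp (hag₁ j)).1)
  have ha0 : ∀ j, a j ≠ 0 := fun j => (Finset.mem_filter.mp (hag₁ j)).2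
  obtain ⟨A, hAO, x', hx', lv', hR₀A, haA, hflagA⟩ :=
    ap_flag_chart_absorbing O hk R₀ hR₀O x hx lv hflag htors hfrac a haO ha0
  have hgA : ∀ z ∈ g, z ∈ A := by
    intro z hz
    by_cases hz0 : z = 0
    · rw [hz0]; exact A.zero_mem
    · have hz₁ : z ∈ g₁ := Finset.mem_filter.mpr ⟨hz, hz0⟩
      have h := haA (g₁.equivFin ⟨z, hz₁⟩)
      simpa [a] using h
  -- (5): `Frac A = K`
  have hfracA : ∀ z : K, ∃ a' ∈ A.toSubring, ∃ b' ∈ A.toSubring, z = a' / b' := by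
    intro z
    have hz : z ∈ Subfield.closure (A : Set K) :=
      Subfield.closure_mono (fun w hw => hR₀A hw) (hfrac z)
    obtain ⟨y, hy, w, hw, rfl⟩ := Subfield.mem_closure_iff.mp hz
    have hcl : Subring.closure (A : Set K) = A.toSubring := Subring.closure_eq A.toSubring
    rw [hcl] at hy hw
    exact ⟨y, hy, w, hw, rfl⟩
  haveI hfrA : IsFractionRing A K := isFractionRing_of_forall_exists_div A.toSubring hfracA
  -- (4): the semigroup of the chart is finitely generated
  refine ⟨A, ?_, hAO, hflagA.1.1, hfrA, qfgHigherRank_flag_semigroup_fg O A hAO x' hx' lv' hflagA⟩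
  rw [← hg, Algebra.adjoin_le_iff]
  exact fun z hz => hgA z hz

/-! ## The registered stub signature, by name

`IsQFGModel` and `Sig.stub_qfgHigherRank` are copied VERBATIM from the line skeleton
`Cruxes/SemivaluationShadows/Lines/birth.lean` (v2); they are `private` (as in the rank-one
sibling file) so that sibling stub files do not clash — the statements unfold definitionally to
the skeleton's. -/

/-- VERBATIM copy of the skeleton's `IsQFGModel O R R₁` (a predicate of the line skeleton, not a
named fact): `R₁` is a local blowing up of `R` along `O` (`R ≤ R₁ ⊆ O`, finitely generated,
`Frac R₁ = K`) on which the value semigroup `ν(R₁)` (with `0 = ν(0)`, as a submonoid of the value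
group with zero) is finitely generated. -/
private def IsQFGModel {k K : Type} [Field k] [Field K] [Algebra k K] (O : ValuationSubring K)
    (R R₁ : Subalgebra k K) : Prop :=
  R ≤ R₁ ∧ R₁.toSubring ≤ O.toSubring ∧ R₁.FG ∧ IsFractionRing R₁ K ∧
    (MonoidHom.mrange (O.valuation.toMonoidWithZeroHom.toMonoidHom.comp
      R₁.val.toRingHom.toMonoidHom)).FG

/-- VERBATIM copy of the skeleton's registered signature `Sig.stub_qfgHigherRank` (the statement
of the stub, PROVED below as `stub_qfgHigherRank` — not a named fact): over an algebraically closed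
field of characteristic `p`, a rational ABHYANKAR valuation ring (`transcendenceDefect = 0`) of a
finitely generated `K/k` whose value group is NOT archimedean admits a QFG model above every
finitely generated `R ⊆ O`. -/
private def Sig.stub_qfgHigherRank : Prop :=
  ∀ p : ℕ, p.Prime → ∀ (k K : Type) [Field k] [CharP k p] [IsAlgClosed k] [Field K] [Algebra k K],
    (⊤ : IntermediateField k K).FG → ∀ (O : ValuationSubring K)
    (hk : ∀ c : k, algebraMap k K c ∈ O),
    (∀ x : K, x ∈ O → ∃ c : k, O.valuation (x - algebraMap k K c) < 1) →
    transcendenceDefect k O hk = 0 →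
    ¬ (∀ z w : K, O.valuation z < 1 → w ≠ 0 → ∃ N : ℕ, O.valuation z ^ N < O.valuation w) →
    ∀ R : Subalgebra k K, R.FG → R.toSubring ≤ O.toSubring → ∃ R₁ : Subalgebra k K, IsQFGModel O R R₁

/-- **STUB `stub_qfgHigherRank` of line `birth` of crux `SemivaluationShadows`, PROVED**
(registered signature `Sig.stub_qfgHigherRank`, by name; it unfolds to the skeleton's statement
verbatim): quasi-finite generation for rational Abhyankar valuation rings of higher rank over an
algebraically closed field of characteristic `p` — `qfgHigherRank`.
[cite: Teissier2014, Thm. 6.21 / Cor. 6.22] -/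
theorem stub_qfgHigherRank : Sig.stub_qfgHigherRank :=
  fun p hp k K _ _ _ _ _ => qfgHigherRank p hp k K

end Summit.ResolutionOfSingularities.ResolutionOfSingularities.Theorems

end
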